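import Mathlib
import Literature.Analysis.Calculus.BorderedImplicitFunction
import HarnessLib

/-!
# Perturbed bordered local solve (Galerkin truncation of the time-periodic lattice equation)

Stub `stub_perturbedBorderedSolve` (S1) of the line `work-lipschitz-cycles` of the crux
`Summit.AnomalousDissipation.AnomalousDissipation.Theses.WazewskiBlock.UniformWorkFloorTrap`
(Galerkin persistence of a nondegenerate time-periodic Navier–Stokes orbit).

Setting (abstract real Banach space `E`, as in
`Literature.Analysis.FluidPDE.TimePeriodicLattice.bordered_local_solve`): the time-periodic map
`G(x, ω) = ω ∂ₛx + L₀x + B(x,x)` with `B` bounded bilinear, `J = ω₀∂ₛ + L₀` a linear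
homeomorphism, `K = B(x₀,·) + B(·,x₀)` compact, and the NONDEGENERACY of `T = J + K`:
`ker T ⊆ ℝ·g`, `∂ₛx₀ ∉ range T`.  Let `P n` be contractions with `‖P n ∘ K − K‖ → 0` and
`P n (B(x₀,x₀)) → B(x₀,x₀)`.  Then for every `δ > 0` and all large `n` the TRUNCATED equation
`ω ∂ₛx + L₀x + P n (B(x,x)) = G(x₀, ω₀)` has a solution `δ`-close to `(x₀, ω₀)`
(Brezzi–Rappaz–Raviart 1980, Part I, Thm. 3: projection approximation of nonsingular solutions).

Proof (quantitative inverse function theorem around a FIXED isomorphism):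
* `exists_borderedEquiv` — the bordered operator `(h, μ) ↦ (T h + μ ∂ₛx₀, φ h)` of
  `Literature.Analysis.Calculus.bordered_bijective` (Hahn–Banach functional `φ` with `φ g ≠ 0`)
  is a linear homeomorphism `L` of `E × ℝ` (open mapping theorem);
* `truncatedRemainder_eq` / `truncatedRemainder_norm_le` — the truncated bordered map
  `Ψₙ(x, ω) = (ω ∂ₛx + L₀x + P n (B(x,x)), φ(x − x₀))` approximates `L` on the closed `ε`-ball
  around `(x₀, ω₀)` with constant `2ε‖∂ₛ‖ + ‖P n ∘ K − K‖ + 2Cε` (`C` the bilinear bound);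
* `stub_perturbedBorderedSolve` — choose `ε` and `N₀` so that this constant is `≤ ‖L⁻¹‖⁻¹/2`
  and `‖P n (B(x₀,x₀)) − B(x₀,x₀)‖ ≤ (‖L⁻¹‖⁻¹/2) ε`; then Mathlib's
  `ApproximatesLinearOn.surjOn_closedBall_of_nonlinearRightInverse` covers `(G(x₀,ω₀), 0)`.
-/

noncomputable section

-- `Summit.<Summit>.<Problem>`: single-conjunct summit, the duplicate namespace is mandated (CONVENTIONS §2).
set_option linter.dupNamespace false

namespace Summit.AnomalousDissipation.AnomalousDissipation.Theorems.UniformWorkFloorTrap.WorkLipschitzCycles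

open Filter Topology Metric Set Function
open scoped Topology NNReal

/-- **The fixed bordered isomorphism.** If `K` is compact, `ker (J + K) ⊆ ℝ·g` and
`e ∉ range (J + K)` for a linear homeomorphism `J` of a real Banach space, then for a suitable
functional `φ` the bordered operator `(h, μ) ↦ (J h + K h + μ • e, φ h)` is a linear homeomorphism
of `E × ℝ` (the bordering lemma `Literature.Analysis.Calculus.bordered_bijective` with a
Hahn–Banach functional, and the open mapping theorem). [folklore] -/
theorem exists_borderedEquiv {E : Type*} [NormedAddCommGroup E] [NormedSpace ℝ E] [CompleteSpace E]
    (J : E ≃L[ℝ] E) (K : E →L[ℝ] E) (hKc : IsCompactOperator K) (e g : E)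
    (hker : ∀ h, J h + K h = 0 → ∃ z : ℝ, h = z • g) (hrange : ∀ h, J h + K h ≠ e) :
    ∃ (φ : E →L[ℝ] ℝ) (L : (E × ℝ) ≃L[ℝ] (E × ℝ)),
      ∀ p : E × ℝ, L p = (J p.1 + K p.1 + p.2 • e, φ p.1) := by
  -- the linearisation `T = J + K`, a compact perturbation of `J`
  obtain ⟨T, hT⟩ : ∃ T : E →L[ℝ] E, T = (J : E →L[ℝ] E) + K := ⟨_, rfl⟩
  have hTx : ∀ h, T h = J h + K h := fun h => by rw [hT]; rfl
  have hTK : IsCompactOperator (T - (J : E →L[ℝ] E) : E →L[ℝ] E) := by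
    have : (T - (J : E →L[ℝ] E) : E →L[ℝ] E) = K := by rw [hT]; abel
    rw [this]; exact hKc
  -- `g ≠ 0` (else `T` injective, hence surjective, contradicting `hrange`)
  have hg0 : g ≠ 0 := by
    intro hg
    have hinj : Injective T := by
      rw [injective_iff_map_eq_zero]
      intro h hh
      obtain ⟨z, rfl⟩ := hker h (by rw [← hTx]; exact hh)
      rw [hg, smul_zero]
    obtain ⟨h, hh⟩ :=
      (Literature.Analysis.Calculus.bijective_of_injective_of_isCompactOperator T J hTK hinj).2 e
    exact hrange h (by rw [← hTx]; exact hh)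
  -- a functional with `φ g ≠ 0`
  obtain ⟨φ, -, hφg⟩ := exists_dual_vector ℝ g (norm_ne_zero_iff.2 hg0)
  have hφ : φ g ≠ 0 := by rw [hφg]; exact_mod_cast norm_ne_zero_iff.2 hg0
  -- the bordered operator is bijective
  have hker' : ∀ h, T h = 0 → ∃ z : ℝ, h = z • g := fun h hh => hker h (by rw [← hTx]; exact hh)
  have hrange' : ∀ h, T h ≠ -e := by
    intro h hh
    refine hrange (-h) ?_
    rw [← hTx, map_neg, hh, neg_neg]
  have hbij := Literature.Analysis.Calculus.bordered_bijective T J hTK g (-e) φ hker' hrange' hφ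
  -- as a continuous linear map on `E × ℝ`
  obtain ⟨Ψ', hΨ'⟩ : ∃ Ψ' : (E × ℝ) →L[ℝ] (E × ℝ),
      Ψ' = (T.comp (ContinuousLinearMap.fst ℝ E ℝ) + (ContinuousLinearMap.snd ℝ E ℝ).smulRight e).prod
        (φ.comp (ContinuousLinearMap.fst ℝ E ℝ)) := ⟨_, rfl⟩
  have hΨ'x : ∀ p : E × ℝ, Ψ' p = (T p.1 - p.2 • (-e), φ p.1) := by
    rintro ⟨h, μ⟩
    rw [hΨ']
    simp only [ContinuousLinearMap.prod_apply, _root_.add_apply,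
      ContinuousLinearMap.comp_apply, ContinuousLinearMap.coe_fst', ContinuousLinearMap.coe_snd',
      ContinuousLinearMap.smulRight_apply, smul_neg, sub_neg_eq_add]
  have hΨ'bij : Bijective Ψ' := by
    have e' : (Ψ' : E × ℝ → E × ℝ) = fun p : E × ℝ => (T p.1 - p.2 • (-e), φ p.1) := funext hΨ'x
    rw [e']; exact hbij
  refine ⟨φ, ContinuousLinearEquiv.ofBijective Ψ' (LinearMap.ker_eq_bot.2 hΨ'bij.1)
    (LinearMap.range_eq_top.2 hΨ'bij.2), fun p => ?_⟩
  rw [ContinuousLinearEquiv.coeFn_ofBijective, hΨ'x, hTx, smul_neg, sub_neg_eq_add]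

/-- **Algebra of the truncated remainder.** First component of `Ψₙ p − Ψₙ p' − L (p − p')` for
the truncated bordered map `Ψₙ(x, ω) = (ω ∂ₛx + L₀x + Q (B(x,x)), φ(x − x₀))` and the bordered
linearisation `L(h, μ) = (ω₀ ∂ₛh + L₀h + K h + μ ∂ₛx₀, φ h)`, `K = B(x₀,·) + B(·,x₀)`:
it equals `(ω−ω₀)∂ₛ(x−x') + (ω−ω')∂ₛ(x'−x₀) + (QK − K)(x−x') + Q(B(x−x', x−x₀) + B(x'−x₀, x−x'))`.
[folklore] -/
theorem truncatedRemainder_eq {E : Type*} [NormedAddCommGroup E] [NormedSpace ℝ E]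
    (Ds L₀ K Q : E →L[ℝ] E) {B : E → E → E} (β : E →L[ℝ] E →L[ℝ] E)
    (hβ : ∀ x y, B x y = β x y) (x₀ : E) (ω₀ : ℝ) (hK : ∀ h, K h = B x₀ h + B h x₀)
    (x x' : E) (ω ω' : ℝ) :
    ω • Ds x + L₀ x + Q (B x x) - (ω' • Ds x' + L₀ x' + Q (B x' x'))
        - (ω₀ • Ds (x - x') + L₀ (x - x') + K (x - x') + (ω - ω') • Ds x₀)
      = (ω - ω₀) • Ds (x - x') + (ω - ω') • Ds (x' - x₀) + (Q (K (x - x')) - K (x - x'))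
        + Q (B (x - x') (x - x₀) + B (x' - x₀) (x - x')) := by
  simp only [hK, hβ, map_sub, map_add, _root_.sub_apply, smul_sub, sub_smul]
  abel

/-- **Estimate of the truncated remainder.** With `‖Q‖ ≤ 1`, `‖B(x,y)‖ ≤ C‖x‖‖y‖` and
`‖x − x₀‖, ‖x' − x₀‖, |ω − ω₀| ≤ ε`, the first component of `Ψₙ p − Ψₙ p' − L (p − p')` has norm
at most `(2ε‖∂ₛ‖ + ‖Q ∘ K − K‖ + 2Cε) · max ‖x − x'‖ |ω − ω'|`. [folklore] -/
theorem truncatedRemainder_norm_le {E : Type*} [NormedAddCommGroup E] [NormedSpace ℝ E]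
    (Ds L₀ K Q : E →L[ℝ] E) {B : E → E → E} (β : E →L[ℝ] E →L[ℝ] E)
    (hβ : ∀ x y, B x y = β x y) (x₀ : E) (ω₀ : ℝ) (hK : ∀ h, K h = B x₀ h + B h x₀)
    (hQ : ‖Q‖ ≤ 1) {C : ℝ} (hC : 0 ≤ C) (hBC : ∀ x y, ‖B x y‖ ≤ C * ‖x‖ * ‖y‖)
    {ε : ℝ} {x x' : E} {ω ω' : ℝ} (hx : ‖x - x₀‖ ≤ ε) (hx' : ‖x' - x₀‖ ≤ ε) (hω : |ω - ω₀| ≤ ε) :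
    ‖ω • Ds x + L₀ x + Q (B x x) - (ω' • Ds x' + L₀ x' + Q (B x' x'))
        - (ω₀ • Ds (x - x') + L₀ (x - x') + K (x - x') + (ω - ω') • Ds x₀)‖
      ≤ (2 * ε * ‖Ds‖ + ‖Q.comp K - K‖ + 2 * C * ε) * max ‖x - x'‖ |ω - ω'| := by
  rw [truncatedRemainder_eq Ds L₀ K Q β hβ x₀ ω₀ hK x x' ω ω']
  have hε : 0 ≤ ε := (norm_nonneg _).trans hx
  have hM0 : 0 ≤ max ‖x - x'‖ |ω - ω'| := le_max_of_le_left (norm_nonneg _)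
  have m1 : ‖x - x'‖ ≤ max ‖x - x'‖ |ω - ω'| := le_max_left _ _
  have m2 : |ω - ω'| ≤ max ‖x - x'‖ |ω - ω'| := le_max_right _ _
  have t1 : ‖(ω - ω₀) • Ds (x - x')‖ ≤ ε * (‖Ds‖ * max ‖x - x'‖ |ω - ω'|) := by
    rw [norm_smul, Real.norm_eq_abs]
    exact mul_le_mul hω ((Ds.le_opNorm _).trans (mul_le_mul_of_nonneg_left m1 (norm_nonneg _)))
      (norm_nonneg _) hε
  have t2 : ‖(ω - ω') • Ds (x' - x₀)‖ ≤ max ‖x - x'‖ |ω - ω'| * (‖Ds‖ * ε) := by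
    rw [norm_smul, Real.norm_eq_abs]
    exact mul_le_mul m2 ((Ds.le_opNorm _).trans (mul_le_mul_of_nonneg_left hx' (norm_nonneg _)))
      (norm_nonneg _) hM0
  have t3 : ‖Q (K (x - x')) - K (x - x')‖ ≤ ‖Q.comp K - K‖ * max ‖x - x'‖ |ω - ω'| := by
    rw [← ContinuousLinearMap.comp_apply, ← _root_.sub_apply]
    exact ((Q.comp K - K).le_opNorm _).trans (mul_le_mul_of_nonneg_left m1 (norm_nonneg _))
  have t4 : ‖Q (B (x - x') (x - x₀) + B (x' - x₀) (x - x'))‖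
      ≤ C * max ‖x - x'‖ |ω - ω'| * ε + C * ε * max ‖x - x'‖ |ω - ω'| := by
    have h1 : ‖B (x - x') (x - x₀)‖ ≤ C * max ‖x - x'‖ |ω - ω'| * ε :=
      (hBC _ _).trans (mul_le_mul (mul_le_mul_of_nonneg_left m1 hC) hx (norm_nonneg _)
        (mul_nonneg hC hM0))
    have h2 : ‖B (x' - x₀) (x - x')‖ ≤ C * ε * max ‖x - x'‖ |ω - ω'| :=
      (hBC _ _).trans (mul_le_mul (mul_le_mul_of_nonneg_left hx' hC) m1 (norm_nonneg _)
        (mul_nonneg hC hε))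
    calc ‖Q (B (x - x') (x - x₀) + B (x' - x₀) (x - x'))‖
        ≤ ‖Q‖ * ‖B (x - x') (x - x₀) + B (x' - x₀) (x - x')‖ := Q.le_opNorm _
      _ ≤ 1 * ‖B (x - x') (x - x₀) + B (x' - x₀) (x - x')‖ :=
          mul_le_mul_of_nonneg_right hQ (norm_nonneg _)
      _ ≤ ‖B (x - x') (x - x₀)‖ + ‖B (x' - x₀) (x - x')‖ := by rw [one_mul]; exact norm_add_le _ _
      _ ≤ _ := add_le_add h1 h2
  have hsum := norm_add_le
    ((ω - ω₀) • Ds (x - x') + (ω - ω') • Ds (x' - x₀) + (Q (K (x - x')) - K (x - x')))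
    (Q (B (x - x') (x - x₀) + B (x' - x₀) (x - x')))
  have hsum3 := norm_add₃_le (a := (ω - ω₀) • Ds (x - x')) (b := (ω - ω') • Ds (x' - x₀))
    (c := Q (K (x - x')) - K (x - x'))
  linarith

/-- **S1 · Perturbed bordered local solve** (abstract; Brezzi–Rappaz–Raviart 1980, Part I, Thm. 3,
for the bordered time-periodic map of `TimePeriodicLattice.bordered_local_solve`). In the setting of
`bordered_local_solve` (`G(x, ω) = ω ∂ₛx + L₀x + B(x,x)`, `J = ω₀∂ₛ + L₀` a linear homeomorphism,
`K = B(x₀,·) + B(·,x₀)` compact, `ker(J + K) ⊆ ℝg`, `∂ₛx₀ ∉ range(J + K)`), let `P_n` be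
contractions with `‖P_n K − K‖ → 0` and `P_n B(x₀,x₀) → B(x₀,x₀)`. Then for every `δ > 0` and all
large `n` the TRUNCATED equation `ω ∂ₛx + L₀x + P_n B(x,x) = G(x₀, ω₀)` has a solution with
`‖x − x₀‖ < δ`, `|ω − ω₀| < δ`. (The bordered isomorphism `L` of `exists_borderedEquiv` is FIXED;
the truncated bordered map `Ψ_n(x, ω) = (ω ∂ₛx + L₀x + P_n B(x,x), φ(x − x₀))` approximates it on
a small closed ball with constant `2ε‖∂ₛ‖ + ‖P_n K − K‖ + 2Cε ≤ ‖L⁻¹‖⁻¹/2`, so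
`ApproximatesLinearOn.surjOn_closedBall_of_nonlinearRightInverse` covers `(G(x₀,ω₀), 0)`, which is
`‖P_n B(x₀,x₀) − B(x₀,x₀)‖`-close to `Ψ_n(x₀, ω₀)`.) [folklore] -/
theorem stub_perturbedBorderedSolve {E : Type} [NormedAddCommGroup E] [NormedSpace ℝ E] [CompleteSpace E]
    (Ds L₀ : E →L[ℝ] E) {B : E → E → E}
    (hBb : IsBoundedBilinearMap ℝ (fun p : E × E => B p.1 p.2)) (x₀ : E) (ω₀ : ℝ)
    (J : E ≃L[ℝ] E) (hJ : ∀ h, J h = ω₀ • Ds h + L₀ h)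
    (K : E →L[ℝ] E) (hK : ∀ h, K h = B x₀ h + B h x₀) (hKc : IsCompactOperator K)
    (g : E) (hker : ∀ h, J h + K h = 0 → ∃ z : ℝ, h = z • g) (hrange : ∀ h, J h + K h ≠ Ds x₀)
    (P : ℕ → E →L[ℝ] E) (hP : ∀ n, ‖P n‖ ≤ 1)
    (hPK : Tendsto (fun n => ‖(P n).comp K - K‖) atTop (𝓝 0))
    (hPB : Tendsto (fun n => P n (B x₀ x₀)) atTop (𝓝 (B x₀ x₀)))
    {δ : ℝ} (hδ : 0 < δ) :
    ∃ N₀ : ℕ, ∀ n, N₀ ≤ n → ∃ (x : E) (ω : ℝ),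
      ω • Ds x + L₀ x + P n (B x x) = ω₀ • Ds x₀ + L₀ x₀ + B x₀ x₀ ∧ ‖x - x₀‖ < δ ∧ |ω - ω₀| < δ := by
  -- ### the fixed bordered isomorphism and the bilinear bound
  obtain ⟨φ, L, hL⟩ := exists_borderedEquiv J K hKc (Ds x₀) g hker hrange
  obtain ⟨C, hC0, hBC⟩ := hBb.bound
  have hBC' : ∀ x y, ‖B x y‖ ≤ C * ‖x‖ * ‖y‖ := fun x y => hBC x y
  have hβ : ∀ x y, B x y = hBb.toContinuousLinearMap x y := fun _ _ => rfl
  -- ### the coercivity constant `a = ‖L⁻¹‖⁻¹ > 0`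
  have hNpos : 0 < ‖(L.symm : E × ℝ →L[ℝ] E × ℝ)‖ := L.norm_symm_pos
  obtain ⟨a, ha⟩ : ∃ a : ℝ, a = ‖(L.symm : E × ℝ →L[ℝ] E × ℝ)‖⁻¹ := ⟨_, rfl⟩
  have ha0 : 0 < a := by rw [ha]; exact inv_pos.2 hNpos
  -- ### the radius `ε ≤ δ / 2` with `2ε‖∂ₛ‖ + 2Cε ≤ a / 4`
  obtain ⟨ε, hε⟩ : ∃ ε : ℝ, ε = min (δ / 2) (a / (8 * (‖Ds‖ + C + 1))) := ⟨_, rfl⟩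
  have hDC : 0 < ‖Ds‖ + C + 1 := by positivity
  have hε0 : 0 < ε := by rw [hε]; exact lt_min (by positivity) (by positivity)
  have hεδ : ε < δ := by rw [hε]; exact (min_le_left _ _).trans_lt (by linarith)
  have hεa : 2 * ε * ‖Ds‖ + 2 * C * ε ≤ a / 4 := by
    have h1 : ε ≤ a / (8 * (‖Ds‖ + C + 1)) := by rw [hε]; exact min_le_right _ _
    have h2 : ε * (8 * (‖Ds‖ + C + 1)) ≤ a := (le_div_iff₀ (by positivity)).1 h1
    nlinarith [norm_nonneg Ds, hC0.le, hε0.le]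
  -- ### the threshold `N₀`
  have h1 : ∀ᶠ n in atTop, ‖(P n).comp K - K‖ < a / 4 :=
    hPK.eventually_lt_const (by positivity)
  have h2 : ∀ᶠ n in atTop, dist (P n (B x₀ x₀)) (B x₀ x₀) < a / 2 * ε :=
    Metric.tendsto_nhds.1 hPB _ (by positivity)
  obtain ⟨N₀, hN₀⟩ := eventually_atTop.1 (h1.and h2)
  refine ⟨N₀, fun n hn => ?_⟩
  obtain ⟨hn1, hn2⟩ := hN₀ n hn
  rw [dist_eq_norm] at hn2
  -- ### the approximation constant of the truncated bordered map
  obtain ⟨c, hc⟩ : ∃ c : ℝ≥0, (c : ℝ) = 2 * ε * ‖Ds‖ + ‖(P n).comp K - K‖ + 2 * C * ε :=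
    ⟨⟨_, by positivity⟩, rfl⟩
  have hca : (c : ℝ) ≤ a / 2 := by rw [hc]; linarith
  -- ### the truncated bordered map approximates `L` on the closed `ε`-ball
  obtain ⟨Ψ, hΨ⟩ : ∃ Ψ : E × ℝ → E × ℝ,
      Ψ = fun p => (p.2 • Ds p.1 + L₀ p.1 + P n (B p.1 p.1), φ (p.1 - x₀)) := ⟨_, rfl⟩
  have hΨp : ∀ p : E × ℝ, Ψ p = (p.2 • Ds p.1 + L₀ p.1 + P n (B p.1 p.1), φ (p.1 - x₀)) :=
    fun p => by rw [hΨ]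
  have happ : ApproximatesLinearOn Ψ (L : E × ℝ →L[ℝ] E × ℝ) (closedBall (x₀, ω₀) ε) c := by
    intro p hp p' hp'
    rw [← closedBall_prod_same, Set.mem_prod, mem_closedBall, mem_closedBall, dist_eq_norm,
      dist_eq_norm, Real.norm_eq_abs] at hp hp'
    rw [hΨp, hΨp, ContinuousLinearEquiv.coe_coe, hL, hJ, Prod.fst_sub, Prod.snd_sub,
      Prod.mk_sub_mk, Prod.mk_sub_mk, Prod.norm_mk]
    refine max_le ?_ ?_
    · calc ‖p.2 • Ds p.1 + L₀ p.1 + P n (B p.1 p.1) - (p'.2 • Ds p'.1 + L₀ p'.1 + P n (B p'.1 p'.1))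
            - (ω₀ • Ds (p.1 - p'.1) + L₀ (p.1 - p'.1) + K (p.1 - p'.1) + (p.2 - p'.2) • Ds x₀)‖
          ≤ (2 * ε * ‖Ds‖ + ‖(P n).comp K - K‖ + 2 * C * ε) * max ‖p.1 - p'.1‖ |p.2 - p'.2| :=
            truncatedRemainder_norm_le Ds L₀ K (P n) hBb.toContinuousLinearMap hβ x₀ ω₀ hK (hP n)
              hC0.le hBC' hp.1 hp'.1 hp.2
        _ = c * ‖p - p'‖ := by
            rw [hc, Prod.norm_def, Prod.fst_sub, Prod.snd_sub, Real.norm_eq_abs]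
    · have h0 : φ (p.1 - x₀) - φ (p'.1 - x₀) - φ (p.1 - p'.1) = 0 := by
        simp only [map_sub]; abel
      rw [h0, norm_zero]
      positivity
  -- ### the quantitative surjectivity
  have hsurj := happ.surjOn_closedBall_of_nonlinearRightInverse L.toNonlinearRightInverse hε0.le
    Subset.rfl
  have hNn : ((L.toNonlinearRightInverse).nnnorm : ℝ) = ‖(L.symm : E × ℝ →L[ℝ] E × ℝ)‖ := rfl
  rw [hNn, ← ha] at hsurj
  have hΨ0 : Ψ (x₀, ω₀) = (ω₀ • Ds x₀ + L₀ x₀ + P n (B x₀ x₀), 0) := by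
    rw [hΨp, sub_self, map_zero]
  have hmem : (ω₀ • Ds x₀ + L₀ x₀ + B x₀ x₀, (0 : ℝ)) ∈ closedBall (Ψ (x₀, ω₀)) ((a - c) * ε) := by
    rw [mem_closedBall, hΨ0, Prod.dist_eq, dist_self, max_eq_left dist_nonneg, dist_eq_norm]
    have e1 : ω₀ • Ds x₀ + L₀ x₀ + B x₀ x₀ - (ω₀ • Ds x₀ + L₀ x₀ + P n (B x₀ x₀))
        = -(P n (B x₀ x₀) - B x₀ x₀) := by abel
    rw [e1, norm_neg]
    calc ‖P n (B x₀ x₀) - B x₀ x₀‖ ≤ a / 2 * ε := hn2.le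
      _ ≤ (a - c) * ε := by nlinarith
  obtain ⟨⟨x, ω⟩, hq, hqΨ⟩ := hsurj hmem
  rw [← closedBall_prod_same, Set.mem_prod, mem_closedBall, mem_closedBall, dist_eq_norm,
    dist_eq_norm, Real.norm_eq_abs] at hq
  refine ⟨x, ω, ?_, hq.1.trans_lt hεδ, hq.2.trans_lt hεδ⟩
  have h1c := congrArg Prod.fst hqΨ
  rw [hΨp] at h1c
  exact h1c

end Summit.AnomalousDissipation.AnomalousDissipation.Theorems.UniformWorkFloorTrap.WorkLipschitzCycles

end
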